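import Summits.CriticalPhenomena.PercolationContinuityZ3.Theorems.Transplant.PlanarSkeletonStepObstruction
import Mathlib.Tactic.FinCases
import HarnessLib

/-!
# GRID-COVERING RIGIDITY: ring obstructions to the outward-step field (ι) of every planar-skeleton interface —
# hexagon antipodality, the `2 × 1`-rectangle law, the square law, and THREE-PATH RIGIDITY

builds on p205010 (kernel theorem, internal audit signed; external expert review pending) — nothing in this file uses p205010.
Lane `prim-bschramm`, seat `prim-bschramm-p4` (gen 19; PART C3 of `HOME/bschramm/P4-GENERAL.md` §41: "be exact about what remains").
Helper file (`--supports stmt-CriticalPhenomena-4575 --as helper`).  Companion of p2's `PlanarSkeletonStepObstruction` (degree / triangle) and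
`SkeletonStabiliserObstruction` (rigid neighbour); the obstructions here see RINGS OF LENGTH 4 AND 6 and kill even the frames-only interface
`PlanarSkeletonFrm` (no symmetry is used).

THE OBSERVATION.  Let `φ : V → ℤ²` carry the field (ι) (`∀ v i σ, ∃ v' ∼ v, φ v' = φ v + σ eᵢ`) and let `v` have degree `≤ 4`.  Then the four
neighbours of `v` sit at the four targets `φ v ± e₀, φ v ± e₁`, one each (`exists_code`, `label_injective`): around such vertices `φ` is a GRAPH
COVERING MAP onto the square grid.  Consequently every closed walk of `G` through vertices of degree `≤ 4` that never returns to the vertex it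
came from two steps earlier maps to a closed NON-BACKTRACKING walk of unit axis steps in `ℤ²`, and
* (`code_square`) a closed non-backtracking walk of length `4` in `ℤ²` is the boundary of a unit square: opposite steps are opposite, consecutive
  steps are perpendicular;
* (`code_hexagon`) a closed non-backtracking walk of length `6` in `ℤ²` is the boundary of a `2 × 1` rectangle: OPPOSITE STEPS ARE OPPOSITE
  (`d₃ = −d₀, d₄ = −d₁, d₅ = −d₂`) and among `d₀, d₁, d₂` two consecutive ones are equal and the third is perpendicular, or `d₂ = −d₀ ⊥ d₁`
  (both by `decide` over the `4⁶` / `4⁴` step codes);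
* (**`threePath_rigidity`**) hence two hexagons of `G` (vertices of degree `≤ 4`) that share three consecutive edges COINCIDE: the fourth step
  is forced to be `−d₀`, and labels at a vertex of degree `≤ 4` are injective.  So **a graph of maximal degree `4` in which some path of length
  `3` lies on two distinct `6`-cycles carries no `PlanarSkeletonFrm`, no `PlanarSkeletonNeg`, no `PlanarSkeletonSign`, no `PlanarSkeletonConc` —
  whatever the chart, the base set, the frames** (`isEmpty_planarSkeletonFrm_of_threePath` …).  Instance (file `LonsdaleiteNoSkeleton`): the
  lonsdaleite net (eclipsed bilayer bonds: the path in-layer/vertical/in-layer lies on two boat rings).  The square and rectangle laws are the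
  tools of the `nbo` and `sod` certificates (files `NboNetNoSkeleton`, `SodaliteNoSkeleton`).
Everything is elementary and [folklore]; the interfaces are those of [cite: KozmaNitzan2024, §4 p. 15 (outward steps), p. 16 (Lemma 8)].
-/

namespace Summit.CriticalPhenomena.PercolationContinuityZ3.Theorems.Transplant

open Literature.Probability.Percolation Literature.Probability.LatticeModels SimpleGraph
open scoped Classical

/-! ## §1 Step codes: `0 ↦ +e₀`, `1 ↦ −e₀`, `2 ↦ +e₁`, `3 ↦ −e₁` -/

namespace GridCover

/-- The opposite step code. [folklore] -/
def opp : Fin 4 → Fin 4 := ![1, 0, 3, 2]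

/-- The axis of a step code (`0` for `±e₀`, `1` for `±e₁`). [folklore] -/
def axis : Fin 4 → Fin 2 := ![0, 0, 1, 1]

/-- The `e₀`-component of a step code. [folklore] -/
def dx : Fin 4 → ℤ := ![1, -1, 0, 0]

/-- The `e₁`-component of a step code. [folklore] -/
def dy : Fin 4 → ℤ := ![0, 0, 1, -1]

/-- The step vector of a code. [folklore] -/
def vec (k : Fin 4) : Site 2 := fun i => if i = 0 then dx k else dy k

/-- `vec k 0 = dx k`. [folklore] -/
@[simp] theorem vec_apply_zero (k : Fin 4) : vec k 0 = dx k := rfl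

/-- `vec k 1 = dy k`. [folklore] -/
@[simp] theorem vec_apply_one (k : Fin 4) : vec k 1 = dy k := rfl

/-- `vec (opp k) = − vec k`. [folklore] -/
theorem vec_opp (k : Fin 4) : vec (opp k) = -vec k := by
  funext i
  fin_cases i <;> fin_cases k <;> rfl

/-- `vec` is injective. [folklore] -/
theorem vec_injective : Function.Injective vec := by
  intro k k' h
  have h0 := congrFun h 0
  have h1 := congrFun h 1
  simp only [vec_apply_zero, vec_apply_one] at h0 h1
  fin_cases k <;> fin_cases k' <;> first | rfl | (exfalso; revert h0 h1; decide)

/-- `vec k = − vec k'` iff `k' = opp k`. [folklore] -/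
theorem vec_eq_neg_iff (k k' : Fin 4) : vec k = -vec k' ↔ k = opp k' := by
  rw [← vec_opp]
  exact ⟨fun h => vec_injective h, fun h => by rw [h]⟩

/-- A unit step `σ eᵢ` (`σ = ±1`) is a coded step. [folklore] -/
theorem exists_code_of_single (i : Fin 2) (σ : ℤˣ) : ∃ k : Fin 4, (Pi.single i (σ : ℤ) : Site 2) = vec k := by
  rcases Int.units_eq_one_or σ with h | h <;> subst h <;> fin_cases i
  · exact ⟨0, by funext j; fin_cases j <;> rfl⟩
  · exact ⟨2, by funext j; fin_cases j <;> rfl⟩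
  · exact ⟨1, by funext j; fin_cases j <;> rfl⟩
  · exact ⟨3, by funext j; fin_cases j <;> rfl⟩

/-- **THE SQUARE LAW** (closed non-backtracking walks of length `4` in `ℤ²` are unit squares): opposite steps opposite, consecutive steps on
different axes. [folklore] -/
theorem code_square : ∀ k₀ k₁ k₂ k₃ : Fin 4,
    dx k₀ + dx k₁ + dx k₂ + dx k₃ = 0 → dy k₀ + dy k₁ + dy k₂ + dy k₃ = 0 →
    k₁ ≠ opp k₀ → k₂ ≠ opp k₁ → k₃ ≠ opp k₂ → k₀ ≠ opp k₃ →
    k₂ = opp k₀ ∧ k₃ = opp k₁ ∧ axis k₁ ≠ axis k₀ := by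
  decide

/-- **HEXAGON ANTIPODALITY AND THE RECTANGLE LAW** (closed non-backtracking walks of length `6` in `ℤ²` are `2 × 1` rectangles): opposite
steps are opposite, and the first three steps have the shape (long, long, short-side structure) `(x, y, y)`, `(y, y, x)` or `(y, x, −y)` with
`x ⊥ y`. [folklore] -/
theorem code_hexagon : ∀ k₀ k₁ k₂ k₃ k₄ k₅ : Fin 4,
    dx k₀ + dx k₁ + dx k₂ + dx k₃ + dx k₄ + dx k₅ = 0 → dy k₀ + dy k₁ + dy k₂ + dy k₃ + dy k₄ + dy k₅ = 0 →
    k₁ ≠ opp k₀ → k₂ ≠ opp k₁ → k₃ ≠ opp k₂ → k₄ ≠ opp k₃ → k₅ ≠ opp k₄ → k₀ ≠ opp k₅ →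
    (k₃ = opp k₀ ∧ k₄ = opp k₁ ∧ k₅ = opp k₂) ∧
      ((k₁ = k₂ ∧ axis k₀ ≠ axis k₁) ∨ (k₀ = k₁ ∧ axis k₂ ≠ axis k₀) ∨ (k₂ = opp k₀ ∧ axis k₁ ≠ axis k₀)) := by
  decide

end GridCover

open GridCover

/-! ## §2 Labels at a vertex of degree `≤ 4` under the field (ι): coded and injective -/

section UnitSteps

variable {V : Type} {G : SimpleGraph V} [G.LocallyFinite] {φ : V → Site 2}
variable (hstep : ∀ (v : V) (i : Fin 2) (σ : ℤˣ), ∃ v' : V, G.Adj v v' ∧ φ v' = φ v + Pi.single i (σ : ℤ))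
include hstep

/-- **Every bond at a vertex of degree `≤ 4` is a coded unit step.** [folklore] -/
theorem exists_code {v u : V} (hv : G.degree v ≤ 4) (h : G.Adj v u) : ∃ k : Fin 4, φ u - φ v = vec k := by
  obtain ⟨i, σ, hφ⟩ := exists_step_of_degree_le hstep hv h
  obtain ⟨k, hk⟩ := exists_code_of_single i σ
  exact ⟨k, by rw [hφ, add_sub_cancel_left, hk]⟩

/-- **Labels are injective at a vertex of degree `≤ 4`**: two neighbours with the same chart value coincide (the four targets are hit by four
distinct neighbours, which exhaust the neighbourhood). [folklore] -/
theorem label_injective {v u u' : V} (hv : G.degree v ≤ 4) (hu : G.Adj v u) (hu' : G.Adj v u') (h : φ u = φ u') : u = u' := by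
  classical
  by_contra hne
  obtain ⟨a, ha, hφa⟩ := hstep v 0 1
  obtain ⟨b, hb, hφb⟩ := hstep v 0 (-1)
  obtain ⟨c, hc, hφc⟩ := hstep v 1 1
  obtain ⟨d, hd, hφd⟩ := hstep v 1 (-1)
  simp only [Units.val_one, Units.val_neg] at hφa hφb hφc hφd
  -- the four targets are values of `φ` on the neighbour finset
  set T : Finset (Site 2) := {φ v + Pi.single 0 (1 : ℤ), φ v + Pi.single 0 (-1 : ℤ), φ v + Pi.single 1 (1 : ℤ),
    φ v + Pi.single 1 (-1 : ℤ)} with hT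
  have hsub : T ⊆ (G.neighborFinset v).image φ := by
    intro y hy
    simp only [hT, Finset.mem_insert, Finset.mem_singleton] at hy
    rw [Finset.mem_image]
    rcases hy with rfl | rfl | rfl | rfl
    · exact ⟨a, (mem_neighborFinset _ _ _).2 ha, hφa⟩
    · exact ⟨b, (mem_neighborFinset _ _ _).2 hb, hφb⟩
    · exact ⟨c, (mem_neighborFinset _ _ _).2 hc, hφc⟩
    · exact ⟨d, (mem_neighborFinset _ _ _).2 hd, hφd⟩
  have h01 : φ v + Pi.single 0 (1 : ℤ) ≠ φ v + Pi.single 0 (-1 : ℤ) := by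
    intro e; have := congrFun (add_left_cancel e) 0; simp at this
  have h02 : φ v + Pi.single 0 (1 : ℤ) ≠ φ v + Pi.single 1 (1 : ℤ) := by
    intro e; have := congrFun (add_left_cancel e) 0; simp at this
  have h03 : φ v + Pi.single 0 (1 : ℤ) ≠ φ v + Pi.single 1 (-1 : ℤ) := by
    intro e; have := congrFun (add_left_cancel e) 0; simp at this
  have h12 : φ v + Pi.single 0 (-1 : ℤ) ≠ φ v + Pi.single 1 (1 : ℤ) := by
    intro e; have := congrFun (add_left_cancel e) 0; simp at this
  have h13 : φ v + Pi.single 0 (-1 : ℤ) ≠ φ v + Pi.single 1 (-1 : ℤ) := by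
    intro e; have := congrFun (add_left_cancel e) 0; simp at this
  have h23 : φ v + Pi.single 1 (1 : ℤ) ≠ φ v + Pi.single 1 (-1 : ℤ) := by
    intro e; have := congrFun (add_left_cancel e) 1; simp at this
  have hcard4 : T.card = 4 := by
    rw [hT, Finset.card_insert_of_notMem, Finset.card_insert_of_notMem, Finset.card_pair h23]
    · simp only [Finset.mem_insert, Finset.mem_singleton, not_or]; exact ⟨h12, h13⟩
    · simp only [Finset.mem_insert, Finset.mem_singleton, not_or]; exact ⟨h01, h02, h03⟩
  -- but two distinct neighbours share a value, so the image has at most `deg v − 1 ≤ 3` elements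
  have hu1 : u ∈ G.neighborFinset v := (mem_neighborFinset _ _ _).2 hu
  have hu2 : u' ∈ G.neighborFinset v := (mem_neighborFinset _ _ _).2 hu'
  have himg : (G.neighborFinset v).image φ ⊆ ((G.neighborFinset v).erase u').image φ := by
    intro y hy
    obtain ⟨w, hw, rfl⟩ := Finset.mem_image.1 hy
    by_cases hwu : w = u'
    · subst hwu
      exact Finset.mem_image.2 ⟨u, Finset.mem_erase.2 ⟨hne, hu1⟩, h⟩
    · exact Finset.mem_image.2 ⟨w, Finset.mem_erase.2 ⟨hwu, hw⟩, rfl⟩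
  have h1 := Finset.card_le_card (hsub.trans himg)
  have h2 : (((G.neighborFinset v).erase u').image φ).card ≤ ((G.neighborFinset v).erase u').card := Finset.card_image_le
  have h3 : ((G.neighborFinset v).erase u').card + 1 = (G.neighborFinset v).card := Finset.card_erase_add_one hu2
  rw [card_neighborFinset_eq_degree] at h3
  omega

/-- Non-backtracking in code form: along `v₀ ∼ v₁ ∼ v₂` with `v₂ ≠ v₀` and `deg v₁ ≤ 4`, the second step is not the reverse of the first.
[folklore] -/
theorem code_ne_opp {v₀ v₁ v₂ : V} (hv₁ : G.degree v₁ ≤ 4) (h₀₁ : G.Adj v₀ v₁) (h₁₂ : G.Adj v₁ v₂) (hne : v₂ ≠ v₀)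
    {k₀ k₁ : Fin 4} (hk₀ : φ v₁ - φ v₀ = vec k₀) (hk₁ : φ v₂ - φ v₁ = vec k₁) : k₁ ≠ opp k₀ := by
  intro h
  apply hne
  apply label_injective hstep hv₁ h₁₂ h₀₁.symm
  have e : φ v₂ - φ v₁ = -(φ v₁ - φ v₀) := by rw [hk₁, hk₀, h, vec_opp]
  calc φ v₂ = (φ v₂ - φ v₁) + φ v₁ := by abel
    _ = -(φ v₁ - φ v₀) + φ v₁ := by rw [e]
    _ = φ v₀ := by abel

/-! ## §3 Squares and hexagons through vertices of degree `≤ 4` -/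

/-- **THE SQUARE LAW in `G`**: around a `4`-cycle `v₀ v₁ v₂ v₃` whose vertices have degree `≤ 4`, the chart steps satisfy `d₂ = −d₀`,
`d₃ = −d₁`, and `d₀ ⊥ d₁`; returned in code form. [folklore] -/
theorem square_codes {v₀ v₁ v₂ v₃ : V} (h₀₁ : G.Adj v₀ v₁) (h₁₂ : G.Adj v₁ v₂) (h₂₃ : G.Adj v₂ v₃) (h₃₀ : G.Adj v₃ v₀)
    (n₀₂ : v₀ ≠ v₂) (n₁₃ : v₁ ≠ v₃)
    (d₀ : G.degree v₀ ≤ 4) (d₁ : G.degree v₁ ≤ 4) (d₂ : G.degree v₂ ≤ 4) (d₃ : G.degree v₃ ≤ 4) :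
    ∃ k₀ k₁ k₂ k₃ : Fin 4, φ v₁ - φ v₀ = vec k₀ ∧ φ v₂ - φ v₁ = vec k₁ ∧ φ v₃ - φ v₂ = vec k₂ ∧ φ v₀ - φ v₃ = vec k₃ ∧
      k₂ = opp k₀ ∧ k₃ = opp k₁ ∧ axis k₁ ≠ axis k₀ := by
  obtain ⟨k₀, hk₀⟩ := exists_code hstep d₀ h₀₁
  obtain ⟨k₁, hk₁⟩ := exists_code hstep d₁ h₁₂
  obtain ⟨k₂, hk₂⟩ := exists_code hstep d₂ h₂₃
  obtain ⟨k₃, hk₃⟩ := exists_code hstep d₃ h₃₀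
  have n₁ := code_ne_opp hstep d₁ h₀₁ h₁₂ n₀₂.symm hk₀ hk₁
  have n₂ := code_ne_opp hstep d₂ h₁₂ h₂₃ n₁₃.symm hk₁ hk₂
  have n₃ := code_ne_opp hstep d₃ h₂₃ h₃₀ n₀₂ hk₂ hk₃
  have n₀ := code_ne_opp hstep d₀ h₃₀ h₀₁ n₁₃ hk₃ hk₀
  have hsum : vec k₀ + vec k₁ + vec k₂ + vec k₃ = 0 := by rw [← hk₀, ← hk₁, ← hk₂, ← hk₃]; abel
  have hx := congrFun hsum 0
  have hy := congrFun hsum 1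
  simp only [Pi.add_apply, vec_apply_zero, vec_apply_one, Pi.zero_apply] at hx hy
  obtain ⟨e₂, e₃, hax⟩ := code_square k₀ k₁ k₂ k₃ hx hy n₁ n₂ n₃ n₀
  exact ⟨k₀, k₁, k₂, k₃, hk₀, hk₁, hk₂, hk₃, e₂, e₃, hax⟩

/-- **HEXAGON ANTIPODALITY in `G`**: around a closed walk `v₀ … v₅` (consecutive vertices adjacent, `v_{i+2} ≠ v_i`, all degrees `≤ 4`) the
chart steps satisfy `d₃ = −d₀, d₄ = −d₁, d₅ = −d₂` and the rectangle law; returned in code form. [folklore] -/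
theorem hexagon_codes {v₀ v₁ v₂ v₃ v₄ v₅ : V} (h₀₁ : G.Adj v₀ v₁) (h₁₂ : G.Adj v₁ v₂) (h₂₃ : G.Adj v₂ v₃) (h₃₄ : G.Adj v₃ v₄)
    (h₄₅ : G.Adj v₄ v₅) (h₅₀ : G.Adj v₅ v₀)
    (n₀₂ : v₀ ≠ v₂) (n₁₃ : v₁ ≠ v₃) (n₂₄ : v₂ ≠ v₄) (n₃₅ : v₃ ≠ v₅) (n₄₀ : v₄ ≠ v₀) (n₅₁ : v₅ ≠ v₁)
    (d₀ : G.degree v₀ ≤ 4) (d₁ : G.degree v₁ ≤ 4) (d₂ : G.degree v₂ ≤ 4) (d₃ : G.degree v₃ ≤ 4) (d₄ : G.degree v₄ ≤ 4)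
    (d₅ : G.degree v₅ ≤ 4) :
    ∃ k₀ k₁ k₂ k₃ k₄ k₅ : Fin 4, φ v₁ - φ v₀ = vec k₀ ∧ φ v₂ - φ v₁ = vec k₁ ∧ φ v₃ - φ v₂ = vec k₂ ∧ φ v₄ - φ v₃ = vec k₃ ∧
      φ v₅ - φ v₄ = vec k₄ ∧ φ v₀ - φ v₅ = vec k₅ ∧ (k₃ = opp k₀ ∧ k₄ = opp k₁ ∧ k₅ = opp k₂) ∧
      ((k₁ = k₂ ∧ axis k₀ ≠ axis k₁) ∨ (k₀ = k₁ ∧ axis k₂ ≠ axis k₀) ∨ (k₂ = opp k₀ ∧ axis k₁ ≠ axis k₀)) := by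
  obtain ⟨k₀, hk₀⟩ := exists_code hstep d₀ h₀₁
  obtain ⟨k₁, hk₁⟩ := exists_code hstep d₁ h₁₂
  obtain ⟨k₂, hk₂⟩ := exists_code hstep d₂ h₂₃
  obtain ⟨k₃, hk₃⟩ := exists_code hstep d₃ h₃₄
  obtain ⟨k₄, hk₄⟩ := exists_code hstep d₄ h₄₅
  obtain ⟨k₅, hk₅⟩ := exists_code hstep d₅ h₅₀
  have n₁ := code_ne_opp hstep d₁ h₀₁ h₁₂ n₀₂.symm hk₀ hk₁
  have n₂ := code_ne_opp hstep d₂ h₁₂ h₂₃ n₁₃.symm hk₁ hk₂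
  have n₃ := code_ne_opp hstep d₃ h₂₃ h₃₄ n₂₄.symm hk₂ hk₃
  have n₄ := code_ne_opp hstep d₄ h₃₄ h₄₅ n₃₅.symm hk₃ hk₄
  have n₅ := code_ne_opp hstep d₅ h₄₅ h₅₀ n₄₀.symm hk₄ hk₅
  have n₀ := code_ne_opp hstep d₀ h₅₀ h₀₁ n₅₁.symm hk₅ hk₀
  have hsum : vec k₀ + vec k₁ + vec k₂ + vec k₃ + vec k₄ + vec k₅ = 0 := by
    rw [← hk₀, ← hk₁, ← hk₂, ← hk₃, ← hk₄, ← hk₅]; abel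
  have hx := congrFun hsum 0
  have hy := congrFun hsum 1
  simp only [Pi.add_apply, vec_apply_zero, vec_apply_one, Pi.zero_apply] at hx hy
  obtain ⟨hanti, hpat⟩ := code_hexagon k₀ k₁ k₂ k₃ k₄ k₅ hx hy n₁ n₂ n₃ n₄ n₅ n₀
  exact ⟨k₀, k₁, k₂, k₃, k₄, k₅, hk₀, hk₁, hk₂, hk₃, hk₄, hk₅, hanti, hpat⟩

/-- **Hexagon antipodality, vector form**: the fourth step of a hexagon through vertices of degree `≤ 4` is minus the first. [folklore] -/
theorem hexagon_fourth_step {v₀ v₁ v₂ v₃ v₄ v₅ : V} (h₀₁ : G.Adj v₀ v₁) (h₁₂ : G.Adj v₁ v₂) (h₂₃ : G.Adj v₂ v₃) (h₃₄ : G.Adj v₃ v₄)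
    (h₄₅ : G.Adj v₄ v₅) (h₅₀ : G.Adj v₅ v₀)
    (n₀₂ : v₀ ≠ v₂) (n₁₃ : v₁ ≠ v₃) (n₂₄ : v₂ ≠ v₄) (n₃₅ : v₃ ≠ v₅) (n₄₀ : v₄ ≠ v₀) (n₅₁ : v₅ ≠ v₁)
    (d₀ : G.degree v₀ ≤ 4) (d₁ : G.degree v₁ ≤ 4) (d₂ : G.degree v₂ ≤ 4) (d₃ : G.degree v₃ ≤ 4) (d₄ : G.degree v₄ ≤ 4)
    (d₅ : G.degree v₅ ≤ 4) : φ v₄ - φ v₃ = -(φ v₁ - φ v₀) := by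
  obtain ⟨k₀, k₁, k₂, k₃, k₄, k₅, hk₀, -, -, hk₃, -, -, ⟨e₃, -, -⟩, -⟩ :=
    hexagon_codes hstep h₀₁ h₁₂ h₂₃ h₃₄ h₄₅ h₅₀ n₀₂ n₁₃ n₂₄ n₃₅ n₄₀ n₅₁ d₀ d₁ d₂ d₃ d₄ d₅
  rw [hk₃, hk₀, e₃, vec_opp]

/-- **THREE-PATH RIGIDITY.**  Two hexagons `v₀ v₁ v₂ v₃ v₄ v₅` and `v₀ v₁ v₂ v₃ w₄ w₅` through vertices of degree `≤ 4` that share the path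
`v₀ v₁ v₂ v₃` coincide: `v₄ = w₄` (and then `v₅ = w₅`).  Only the first hexagon's non-degeneracy at `v₄, v₅` is needed for `v₄ = w₄`. [folklore] -/
theorem threePath_rigidity {v₀ v₁ v₂ v₃ v₄ v₅ w₄ w₅ : V} (h₀₁ : G.Adj v₀ v₁) (h₁₂ : G.Adj v₁ v₂) (h₂₃ : G.Adj v₂ v₃)
    (h₃₄ : G.Adj v₃ v₄) (h₄₅ : G.Adj v₄ v₅) (h₅₀ : G.Adj v₅ v₀) (g₃₄ : G.Adj v₃ w₄) (g₄₅ : G.Adj w₄ w₅) (g₅₀ : G.Adj w₅ v₀)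
    (n₀₂ : v₀ ≠ v₂) (n₁₃ : v₁ ≠ v₃) (n₂₄ : v₂ ≠ v₄) (n₃₅ : v₃ ≠ v₅) (n₄₀ : v₄ ≠ v₀) (n₅₁ : v₅ ≠ v₁)
    (m₂₄ : v₂ ≠ w₄) (m₃₅ : v₃ ≠ w₅) (m₄₀ : w₄ ≠ v₀) (m₅₁ : w₅ ≠ v₁)
    (d₀ : G.degree v₀ ≤ 4) (d₁ : G.degree v₁ ≤ 4) (d₂ : G.degree v₂ ≤ 4) (d₃ : G.degree v₃ ≤ 4) (d₄ : G.degree v₄ ≤ 4)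
    (d₅ : G.degree v₅ ≤ 4) (c₄ : G.degree w₄ ≤ 4) (c₅ : G.degree w₅ ≤ 4) : v₄ = w₄ ∧ v₅ = w₅ := by
  have e₁ := hexagon_fourth_step hstep h₀₁ h₁₂ h₂₃ h₃₄ h₄₅ h₅₀ n₀₂ n₁₃ n₂₄ n₃₅ n₄₀ n₅₁ d₀ d₁ d₂ d₃ d₄ d₅
  have e₂ := hexagon_fourth_step hstep h₀₁ h₁₂ h₂₃ g₃₄ g₄₅ g₅₀ n₀₂ n₁₃ m₂₄ m₃₅ m₄₀ m₅₁ d₀ d₁ d₂ d₃ c₄ c₅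
  have h4 : v₄ = w₄ := by
    apply label_injective hstep d₃ h₃₄ g₃₄
    have : φ v₄ - φ v₃ = φ w₄ - φ v₃ := by rw [e₁, e₂]
    exact sub_left_injective this
  refine ⟨h4, ?_⟩
  subst h4
  -- second hexagon read backwards from `v₀`: the steps `v₀ → v₅ → v₄` and `v₀ → w₅ → v₄`; use antipodality of the rotated hexagons
  have f₁ := hexagon_fourth_step hstep h₁₂ h₂₃ h₃₄ h₄₅ h₅₀ h₀₁ n₁₃ n₂₄ n₃₅ n₄₀ n₅₁ n₀₂ d₁ d₂ d₃ d₄ d₅ d₀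
  have f₂ := hexagon_fourth_step hstep h₁₂ h₂₃ h₃₄ g₄₅ g₅₀ h₀₁ n₁₃ n₂₄ m₃₅ m₄₀ m₅₁ n₀₂ d₁ d₂ d₃ d₄ c₅ d₀
  apply label_injective hstep d₄ h₄₅ g₄₅
  have : φ v₅ - φ v₄ = φ w₅ - φ v₄ := by rw [f₁, f₂]
  exact sub_left_injective this

/-- **THE THREE-PATH OBSTRUCTION**: if a path of length `3` through vertices of degree `≤ 4` lies on two DISTINCT hexagons (differing in the
fourth vertex), the field (ι) is impossible. [folklore] -/
theorem false_of_threePath {v₀ v₁ v₂ v₃ v₄ v₅ w₄ w₅ : V} (h₀₁ : G.Adj v₀ v₁) (h₁₂ : G.Adj v₁ v₂) (h₂₃ : G.Adj v₂ v₃)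
    (h₃₄ : G.Adj v₃ v₄) (h₄₅ : G.Adj v₄ v₅) (h₅₀ : G.Adj v₅ v₀) (g₃₄ : G.Adj v₃ w₄) (g₄₅ : G.Adj w₄ w₅) (g₅₀ : G.Adj w₅ v₀)
    (n₀₂ : v₀ ≠ v₂) (n₁₃ : v₁ ≠ v₃) (n₂₄ : v₂ ≠ v₄) (n₃₅ : v₃ ≠ v₅) (n₄₀ : v₄ ≠ v₀) (n₅₁ : v₅ ≠ v₁)
    (m₂₄ : v₂ ≠ w₄) (m₃₅ : v₃ ≠ w₅) (m₄₀ : w₄ ≠ v₀) (m₅₁ : w₅ ≠ v₁) (hvw : v₄ ≠ w₄)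
    (d₀ : G.degree v₀ ≤ 4) (d₁ : G.degree v₁ ≤ 4) (d₂ : G.degree v₂ ≤ 4) (d₃ : G.degree v₃ ≤ 4) (d₄ : G.degree v₄ ≤ 4)
    (d₅ : G.degree v₅ ≤ 4) (c₄ : G.degree w₄ ≤ 4) (c₅ : G.degree w₅ ≤ 4) : False :=
  hvw (threePath_rigidity hstep h₀₁ h₁₂ h₂₃ h₃₄ h₄₅ h₅₀ g₃₄ g₄₅ g₅₀ n₀₂ n₁₃ n₂₄ n₃₅ n₄₀ n₅₁ m₂₄ m₃₅ m₄₀ m₅₁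
    d₀ d₁ d₂ d₃ d₄ d₅ c₄ c₅).1

end UnitSteps

/-! ## §4 The obstruction for the four planar-skeleton interfaces -/

section Interfaces

variable {V : Type} {G : SimpleGraph V} [G.LocallyFinite]

/-- **A "three-path configuration"**: a path `v₀ v₁ v₂ v₃` lying on two hexagons `… v₄ v₅` and `… w₄ w₅` with `v₄ ≠ w₄`, all ten vertices
of degree `≤ 4`, with the non-degeneracy conditions of `false_of_threePath`.  Packaged so that instances supply ONE term. [folklore] -/
structure ThreePathConfig (G : SimpleGraph V) [G.LocallyFinite] where
  /-- the vertices: the shared path `v 0, v 1, v 2, v 3`, the first closing pair `v 4, v 5`, the second closing pair `w4, w5` -/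
  (v₀ v₁ v₂ v₃ v₄ v₅ w₄ w₅ : V)
  (h₀₁ : G.Adj v₀ v₁) (h₁₂ : G.Adj v₁ v₂) (h₂₃ : G.Adj v₂ v₃) (h₃₄ : G.Adj v₃ v₄) (h₄₅ : G.Adj v₄ v₅) (h₅₀ : G.Adj v₅ v₀)
  (g₃₄ : G.Adj v₃ w₄) (g₄₅ : G.Adj w₄ w₅) (g₅₀ : G.Adj w₅ v₀)
  (n₀₂ : v₀ ≠ v₂) (n₁₃ : v₁ ≠ v₃) (n₂₄ : v₂ ≠ v₄) (n₃₅ : v₃ ≠ v₅) (n₄₀ : v₄ ≠ v₀) (n₅₁ : v₅ ≠ v₁)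
  (m₂₄ : v₂ ≠ w₄) (m₃₅ : v₃ ≠ w₅) (m₄₀ : w₄ ≠ v₀) (m₅₁ : w₅ ≠ v₁) (hvw : v₄ ≠ w₄)
  (d₀ : G.degree v₀ ≤ 4) (d₁ : G.degree v₁ ≤ 4) (d₂ : G.degree v₂ ≤ 4) (d₃ : G.degree v₃ ≤ 4) (d₄ : G.degree v₄ ≤ 4)
  (d₅ : G.degree v₅ ≤ 4) (c₄ : G.degree w₄ ≤ 4) (c₅ : G.degree w₅ ≤ 4)

/-- A three-path configuration excludes the field (ι) for every chart. [folklore] -/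
theorem ThreePathConfig.false_of_unitSteps (C : ThreePathConfig G) {φ : V → Site 2}
    (hstep : ∀ (v : V) (i : Fin 2) (σ : ℤˣ), ∃ v' : V, G.Adj v v' ∧ φ v' = φ v + Pi.single i (σ : ℤ)) : False :=
  false_of_threePath hstep C.h₀₁ C.h₁₂ C.h₂₃ C.h₃₄ C.h₄₅ C.h₅₀ C.g₃₄ C.g₄₅ C.g₅₀ C.n₀₂ C.n₁₃ C.n₂₄ C.n₃₅ C.n₄₀ C.n₅₁
    C.m₂₄ C.m₃₅ C.m₄₀ C.m₅₁ C.hvw C.d₀ C.d₁ C.d₂ C.d₃ C.d₄ C.d₅ C.c₄ C.c₅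

/-- **No `PlanarSkeletonFrm`** (frames-only interface; hence nothing for N2 / U) on a graph with a three-path configuration. [folklore] -/
theorem isEmpty_planarSkeletonFrm_of_threePath (C : ThreePathConfig G) : IsEmpty (PlanarSkeletonFrm G) :=
  ⟨fun Φ => C.false_of_unitSteps Φ.step⟩

/-- **No `PlanarSkeletonNeg`** on a graph with a three-path configuration. [folklore] -/
theorem isEmpty_planarSkeletonNeg_of_threePath (C : ThreePathConfig G) : IsEmpty (PlanarSkeletonNeg G) :=
  ⟨fun Φ => C.false_of_unitSteps Φ.step⟩

/-- **No `PlanarSkeletonSign`** (the CLOSED D″ nodes' input) on a graph with a three-path configuration. [folklore] -/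
theorem isEmpty_planarSkeletonSign_of_threePath (C : ThreePathConfig G) : IsEmpty (PlanarSkeletonSign G) :=
  ⟨fun Φ => C.false_of_unitSteps Φ.step⟩

/-- **No `PlanarSkeletonConc`** (the node of record's input) on a graph with a three-path configuration. [folklore] -/
theorem isEmpty_planarSkeletonConc_of_threePath (C : ThreePathConfig G) : IsEmpty (PlanarSkeletonConc G) :=
  ⟨fun Φ => C.false_of_unitSteps Φ.step⟩

end Interfaces

end Summit.CriticalPhenomena.PercolationContinuityZ3.Theorems.Transplant
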